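import Literature.AlgebraicGeometry.Motives.SubfamilyContainedInClosedFormsVanish
import Literature.AlgebraicGeometry.Motives.SubfamilyContainedInClosedAffine
import Literature.AlgebraicGeometry.Motives.SubfamilyContainedInClosedIdeal
import Literature.AlgebraicGeometry.Motives.SubschemeMonomialMap
import Literature.AlgebraicGeometry.Morphisms.IdealSheafContainmentLocal
import HarnessLib

/-!
# The closed locus «the flat sub-family lies in the fixed closed `W`» and its functor of points (`Hilb(W/S) ⊂ Hilb(ℙ/S)` is closed)
# (II-b (b1) FILE 2A, THE HEAD)

Layer `Literature/AlgebraicGeometry/Motives`, namespace `Literature.AlgebraicGeometry.Motives`.  THEOREMS ONLY (no `def`, no instance, no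
notation, no named fact, no `sorry`); universe `0`.  Cell `hodgecm-mathlib` (D-0151 ∕ FLOOR 0), P1 sub-line F-4 layer 2, sub-stub (II-b) «the
Hom-scheme», brick (b1) «sub-families inside a fixed closed `W ⊂ 𝐏(ι; T)` form a CLOSED sub-functor», FILE 2A HEAD = §1 letter of B-p20 (g14)'s
blueprint `BLUEPRINT-F4-IIb-b1-FILE2A` (author B-p20 (g15)); consumed by the II-b child line `F4IIbHomScheme`, stub `stub_IIb4B2_closedLayer`
(B-p14 (g20) skeleton v0.2).  Count-neutral capital (`--supports stmt-HodgeConjecture-24835`); HC_CM is proved only modulo the 7 printed citations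
until rung 0 closes, and nothing here bears on it.

## The source, as printed

[Kollar1996] I Thm. 1.10 and its proof («`Hilb(W) ⊂ Hilb(ℙ)` is the closed subscheme defined by the vanishing of the restrictions of the equations
of `W`»), [MumfordFogartyKirwan1994] Ch. 0 §5 (c) (p. 23), [FGA] no. 221 §4.c; the cohomology-and-base-change input is [Mumford1966CurvesSurface]
Lecture 15 (II.) (p. 106) and [Hartshorne1977] III Prop. 9.3 (p. 255), III Thm. 12.11; locality of the statement on the test scheme is
[GortzWedhorn2020] Prop. 3.5 (p. 70), Prop. 4.20 (p. 104), and the affine charts `Spec Γ(T′, U) → Spec Γ(T, V)` are [GortzWedhorn2020] Prop. 3.4 ∕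
Mathlib `IsAffineOpen.SpecMap_appLE_fromSpec`.

## Statements

* §1 `pullback_map_eq_zero_of_comp` (a morphism killed by `b^*` is killed by `(u ≫ b)^*`, Mathlib `pullbackComp`) and
  **`ker_comap_le_of_forall_pullback_map_eq_zero`** — direction «equations ⇒ containment» for an ARBITRARY test scheme `T′`, glued from the
  affine core (★-to-be `Motives/SubfamilyContainedInClosedAffine`) over the cover of `T′` by the affine opens `U ⊆ b⁻¹V`, `V ⊆ T` affine
  (★-to-be `Morphisms/IdealSheafContainmentLocal.comap_projectiveSpaceMap_le_iff_forall_openCover`).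
* §2 **`exists_idealSheafData_containedIn_iff`** — THE HEAD (core form): for `T` locally Noetherian, `i : Z ⟶ 𝐏(ι; T)` and `iW : W ⟶ 𝐏(ι; T)`
  closed, and `(p_Z)_* 𝒪_Z(m)` finite locally free with base change (binders `hF`, `hbc`) for `m ≥ m₀`: THERE IS an ideal sheaf `V` on `T` with
  `V ≤ ker b^♯ ↔ 𝓘_W · 𝒪_{𝐏(ι;T′)} ≤ 𝓘_Z · 𝒪_{𝐏(ι;T′)}` for EVERY `b : T′ → T` — «`b` factors through the closed subscheme `V(V) ⊆ T` iff
  `Z_{T′} ⊂ W_{T′}`».  `V := ⨆_{m ≥ m₀} V(kernel.ι ψ_{W,m} ≫ ψ_{Z,m})` (★-to-be `Motives/SubfamilyContainedInClosedIdeal`), monomial maps from ★-to-be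
  `Motives/SubschemeMonomialMap`; (←) ★-to-be `Motives/SubfamilyContainedInClosedFormsVanish`.
* §3 **`exists_idealSheafData_containedIn_iff_of_letters`** — the same from the LETTERS of the Hilbert-scheme currency: `Z` FLAT over `T` and, at every
  field point, `Ext¹ = 0` and `dim H⁰ = Q(e)` for `e ≥ B(Q) − 1` (`Q` admissible) — ★ `Modules/ProjectiveFamilyTwistPushforward`
  (`hasRank_pushforward_twistMod_of_forall_fieldPoint`, `isIso_pushforwardBaseChangeHom_twistMod_of_forall_fieldPoint`).  This is the shape of
  `stub_IIb4B2_closedLayer` (`T := HS`, `iW := pullback.snd jW 𝐏(h)`).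

## References
* [Kollar1996] J. Kollár, *Rational Curves on Algebraic Varieties* (1996), I Thm. 1.10 (with proof).
* [MumfordFogartyKirwan1994] D. Mumford, J. Fogarty, F. Kirwan, *Geometric Invariant Theory*, 3rd ed. (1994), Ch. 0 §5 (c) (p. 23).
* [Mumford1966CurvesSurface] D. Mumford, *Lectures on Curves on an Algebraic Surface* (1966), Lecture 15 (II.) (p. 106), (IV.)–(V.) (pp. 107–108).
* [Hartshorne1977] R. Hartshorne, *Algebraic Geometry* (1977), III Prop. 9.3 (p. 255), III Thm. 12.11 (p. 290), II Prop. 5.12 (c) (p. 117), II §5 (p. 110).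
* [GortzWedhorn2020] U. Görtz, T. Wedhorn, *Algebraic Geometry I*, 2nd ed. (2020), Prop. 3.5 (p. 70), Prop. 4.20 (p. 104), Prop. 7.24 (2).
-/

noncomputable section

-- `TopCat.Presheaf`/`Scheme.Modules` are not reducible (as in Mathlib's `AlgebraicGeometry/Modules/Sheaf.lean`).
set_option backward.isDefEq.respectTransparency false

open CategoryTheory CategoryTheory.Limits CategoryTheory.Abelian AlgebraicGeometry TopologicalSpace Opposite Polynomial
open Literature.Algebra.Homology Literature.Algebra.Homology.LaurentCech
open Literature.AlgebraicGeometry.Morphisms Literature.AlgebraicGeometry.Morphisms.ProjCech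
open Literature.AlgebraicGeometry.Modules Literature.AlgebraicGeometry.Modules.SerreTwist

namespace Literature.AlgebraicGeometry.Motives

/-! ### §1 Direction «equations ⇒ containment» for an arbitrary test scheme -/

section Glue

/-- A morphism of `𝒪_T`-modules killed by `b^*` is killed by `(u ≫ b)^* ≅ u^* ∘ b^*` (Mathlib `Scheme.Modules.pullbackComp`).
[cite: Hartshorne1977, II §5 (p. 110)] -/
theorem pullback_map_eq_zero_of_comp {T'' T' T : Scheme.{0}} (u : T'' ⟶ T') (b : T' ⟶ T) {M N : T.Modules} (α : M ⟶ N)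
    (h : (Scheme.Modules.pullback b).map α = 0) : (Scheme.Modules.pullback (u ≫ b)).map α = 0 := by
  have hnat := (Scheme.Modules.pullbackComp u b).hom.naturality α
  rw [Functor.comp_map, h, Functor.map_zero, Limits.zero_comp] at hnat
  rw [← cancel_epi ((Scheme.Modules.pullbackComp u b).hom.app M), ← hnat, Limits.comp_zero]

variable {ι : Type} {T Z W : Scheme.{0}} [IsLocallyNoetherian T] (i : Z ⟶ Morphisms.projectiveSpace ι T) [IsClosedImmersion i]
  (iW : W ⟶ Morphisms.projectiveSpace ι T) [IsClosedImmersion iW]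
  (ψZ : ∀ m : ℕ, freeModule T (Fin m → Fin (Nat.card ι + 1)) ⟶ (Scheme.Modules.pushforward (i ≫ Morphisms.projectiveSpaceFst ι T)).obj
    (twistMod (i ≫ pullback.snd (terminal.from T) (terminal.from (Morphisms.projectiveSpaceInt ι))) (unitModule Z) m))
  (hψZ : ∀ (m : ℕ) (w : Fin m → Fin (Nat.card ι + 1)) (V : T.Opens), (ψZ m).app V (freeSectionOn T w V) =
    ((Scheme.Modules.pushforward (i ≫ Morphisms.projectiveSpaceFst ι T)).obj
      (twistMod (i ≫ pullback.snd (terminal.from T) (terminal.from (Morphisms.projectiveSpaceInt ι))) (unitModule Z) m)).presheaf.map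
      (homOfLE (le_top : V ≤ ⊤)).op
      (show Γ((Scheme.Modules.pushforward (i ≫ Morphisms.projectiveSpaceFst ι T)).obj
        (twistMod (i ≫ pullback.snd (terminal.from T) (terminal.from (Morphisms.projectiveSpaceInt ι))) (unitModule Z) m), ⊤) from
        monomialSection (i ≫ pullback.snd (terminal.from T) (terminal.from (Morphisms.projectiveSpaceInt ι))) m w))
  (ψW : ∀ m : ℕ, freeModule T (Fin m → Fin (Nat.card ι + 1)) ⟶ (Scheme.Modules.pushforward (iW ≫ Morphisms.projectiveSpaceFst ι T)).obj
    (twistMod (iW ≫ pullback.snd (terminal.from T) (terminal.from (Morphisms.projectiveSpaceInt ι))) (unitModule W) m))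
  (hψW : ∀ (m : ℕ) (w : Fin m → Fin (Nat.card ι + 1)) (V : T.Opens), (ψW m).app V (freeSectionOn T w V) =
    ((Scheme.Modules.pushforward (iW ≫ Morphisms.projectiveSpaceFst ι T)).obj
      (twistMod (iW ≫ pullback.snd (terminal.from T) (terminal.from (Morphisms.projectiveSpaceInt ι))) (unitModule W) m)).presheaf.map
      (homOfLE (le_top : V ≤ ⊤)).op
      (show Γ((Scheme.Modules.pushforward (iW ≫ Morphisms.projectiveSpaceFst ι T)).obj
        (twistMod (iW ≫ pullback.snd (terminal.from T) (terminal.from (Morphisms.projectiveSpaceInt ι))) (unitModule W) m), ⊤) from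
        monomialSection (iW ≫ pullback.snd (terminal.from T) (terminal.from (Morphisms.projectiveSpaceInt ι))) m w))
  (m₀ : ℕ)

include hψZ hψW in
/-- **Equations force containment, over an arbitrary test scheme.**  Let `Z, W ⊂ 𝐏(ι; T)` be closed (`T` locally Noetherian) with monomial maps
`ψ_{Z,m}`, `ψ_{W,m}`, and let `b : T′ → T` be ANY morphism with `b^* (kernel.ι ψ_{W,m} ≫ ψ_{Z,m}) = 0` for all `m ≥ m₀`.  Then
`𝓘_W · 𝒪_{𝐏(ι;T′)} ≤ 𝓘_Z · 𝒪_{𝐏(ι;T′)}`, i.e. `Z_{T′} ⊂ W_{T′}`: containment after `𝐏(b)` is local on `T′` (★-to-be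
`comap_projectiveSpaceMap_le_iff_forall_openCover`) for the cover by the affine opens `U ⊆ b⁻¹V` (`V ⊆ T` affine, so `Γ(T, V)` Noetherian), on which
`U = Spec Γ(T′, U) → Spec Γ(T, V) ⊆ T` (Mathlib `IsAffineOpen.SpecMap_appLE_fromSpec`) and the affine core applies.
[cite: Kollar1996, I Thm. 1.10 (proof)] [cite: GortzWedhorn2020, Prop. 3.5 (p. 70) and Prop. 4.20 (p. 104)] -/
theorem ker_comap_le_of_forall_pullback_map_eq_zero {T' : Scheme.{0}} (b : T' ⟶ T)
    (h : ∀ m, m₀ ≤ m → (Scheme.Modules.pullback b).map (kernel.ι (ψW m) ≫ ψZ m) = 0) :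
    iW.ker.comap (Morphisms.projectiveSpaceMap ι b) ≤ i.ker.comap (Morphisms.projectiveSpaceMap ι b) := by
  -- the cover of `T'` by the affine opens `U ⊆ b⁻¹V`, `V ⊆ T` affine
  let 𝒰 : T'.OpenCover := Scheme.Cover.mkOfCovers
    (J := {p : T.affineOpens × T'.affineOpens // (p.2 : T'.Opens) ≤ b ⁻¹ᵁ (p.1 : T.Opens)})
    (fun k => Spec Γ(T', (k.1.2 : T'.Opens))) (fun k => k.1.2.2.fromSpec) fun t => by
      obtain ⟨V, hV, hbt, -⟩ := (Opens.isBasis_iff_nbhd.mp T.isBasis_affineOpens) (show b.base t ∈ (⊤ : T.Opens) from trivial)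
      obtain ⟨U, hU, htU, hUV⟩ := (Opens.isBasis_iff_nbhd.mp T'.isBasis_affineOpens) (show t ∈ b ⁻¹ᵁ V from hbt)
      obtain ⟨y, hy⟩ := hU.range_fromSpec.ge htU
      exact ⟨⟨(⟨V, hV⟩, ⟨U, hU⟩), hUV⟩, y, hy⟩
  rw [comap_projectiveSpaceMap_le_iff_forall_openCover ι b 𝒰]
  rintro ⟨⟨⟨V, hV⟩, ⟨U, hU⟩⟩, hUV⟩
  change U ≤ b ⁻¹ᵁ V at hUV
  change iW.ker.comap (Morphisms.projectiveSpaceMap ι (hU.fromSpec ≫ b)) ≤ i.ker.comap (Morphisms.projectiveSpaceMap ι (hU.fromSpec ≫ b))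
  rw [← IsAffineOpen.SpecMap_appLE_fromSpec b hV hU hUV]
  haveI : IsNoetherianRing Γ(T, V) := IsLocallyNoetherian.component_noetherian ⟨V, hV⟩
  letI := (b.appLE V U hUV).hom.toAlgebra
  exact ker_comap_le_of_forall_pullback_map_eq_zero_affine i iW ψZ hψZ ψW hψW m₀ hV.fromSpec Γ(T', U) fun m hm => by
    have hz := pullback_map_eq_zero_of_comp hU.fromSpec b _ (h m hm)
    rwa [← IsAffineOpen.SpecMap_appLE_fromSpec b hV hU hUV] at hz

end Glue

/-! ### §2 The head: the closed locus and its functor of points -/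

section Head

variable {ι : Type} {T Z W : Scheme.{0}} [IsLocallyNoetherian T] (i : Z ⟶ Morphisms.projectiveSpace ι T) [IsClosedImmersion i]
  (iW : W ⟶ Morphisms.projectiveSpace ι T) [IsClosedImmersion iW]

/-- **THE CLOSED LOCUS «THE SUB-FAMILY LIES IN `W`» (`Hilb(W/S)` is closed in `Hilb(ℙ/S)`), core form.**  Let `T` be locally Noetherian,
`i : Z ⊂ 𝐏(ι; T)` and `iW : W ⊂ 𝐏(ι; T)` closed, and suppose that for `m ≥ m₀` the direct image `(p_Z)_* 𝒪_Z(m)` is finite locally free (`hF`) and its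
formation commutes with every base change (`hbc` — e.g. `Z` flat over `T` with `H¹ = 0` on the fibres, [Mumford1966CurvesSurface] Lecture 15 (II.)).
THEN there is an ideal sheaf `V` on `T` such that for EVERY morphism `b : T′ → T`:
`V ≤ ker b^♯` (⟺ `b` factors through the closed subscheme `V(V)`) **iff** `𝓘_W · 𝒪_{𝐏(ι;T′)} ≤ 𝓘_Z · 𝒪_{𝐏(ι;T′)}` (⟺ `Z_{T′} ⊂ W_{T′}`).
`V = ⨆_{m ≥ m₀} V(α_m)`, `α_m = kernel.ι ψ_{W,m} ≫ ψ_{Z,m}` the restriction to `Z` of the degree-`m` forms vanishing on `W`.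
[cite: Kollar1996, I Thm. 1.10 (with proof)] [cite: MumfordFogartyKirwan1994, Ch. 0 §5 (c) (p. 23)] [cite: Mumford1966CurvesSurface, Lecture 15 (IV.)–(V.) (pp. 107–108)] -/
theorem exists_idealSheafData_containedIn_iff (m₀ : ℕ)
    (hF : ∀ m, m₀ ≤ m → IsFiniteLocallyFree ((Scheme.Modules.pushforward (i ≫ Morphisms.projectiveSpaceFst ι T)).obj
      (twistMod (i ≫ pullback.snd (terminal.from T) (terminal.from (Morphisms.projectiveSpaceInt ι))) (unitModule Z) m)))
    (hbc : ∀ m, m₀ ≤ m → ∀ ⦃T' ZT' : Scheme.{0}⦄ ⦃pr : ZT' ⟶ Z⦄ ⦃pT' : ZT' ⟶ T'⦄ ⦃b : T' ⟶ T⦄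
      (H : IsPullback pr pT' (i ≫ Morphisms.projectiveSpaceFst ι T) b),
      IsIso (pushforwardBaseChangeHom H.w
        (twistMod (i ≫ pullback.snd (terminal.from T) (terminal.from (Morphisms.projectiveSpaceInt ι))) (unitModule Z) m))) :
    ∃ V : T.IdealSheafData, ∀ ⦃T' : Scheme.{0}⦄ (b : T' ⟶ T),
      V ≤ b.ker ↔ iW.ker.comap (Morphisms.projectiveSpaceMap ι b) ≤ i.ker.comap (Morphisms.projectiveSpaceMap ι b) := by
  classical
  -- the monomial maps of `Z` and `W` in every degree
  choose ψZ hψZ using fun m : ℕ => exists_monomialMap_subscheme i m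
  choose ψW hψW using fun m : ℕ => exists_monomialMap_subscheme iW m
  -- the ideal `V := ⨆_{m ≥ m₀} V(α_m)` and its functor of points in terms of `b^* α_m = 0`
  obtain ⟨V, hV⟩ := exists_idealSheafData_le_ker_iff_forall_pullback_map_eq_zero i iW ψZ ψW m₀ hF
  refine ⟨V, fun T' b => (hV b).trans ⟨fun h => ?_, fun h m hm => ?_⟩⟩
  · exact ker_comap_le_of_forall_pullback_map_eq_zero i iW ψZ hψZ ψW hψW m₀ b h
  · exact pullback_map_restrictForms_eq_zero_of_ker_comap_le i iW m (ψZ m) (hψZ m) (ψW m) (hψW m) b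
      (fun _ _ _ H => hbc m hm H) h

/-- **THE CLOSED LOCUS, from the letters of the Hilbert-scheme currency** (the shape of `stub_IIb4B2_closedLayer` of the II-b child line): for
`Z ⊂ 𝐏(ι; T)` closed and FLAT over the locally Noetherian `T`, `W ⊂ 𝐏(ι; T)` closed, and an admissible polynomial `Q` (natural values from `B(Q) − 1`
on) such that at every field point `x : Spec K → T` the fibre `X₀ = Z ×_T Spec K` has `Ext¹(𝒪_{X₀}, 𝒪_Z(e)|_{X₀}) = 0` and
`dim_K Γ(X₀, 𝒪_Z(e)|_{X₀}) = Q(e)` for `e ≥ B(Q) − 1`: there is an ideal sheaf `V` on `T` with `V ≤ ker b^♯ ↔ 𝓘_W · 𝒪 ≤ 𝓘_Z · 𝒪` on `𝐏(ι; T′)` for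
every `b : T′ → T`.  (Cohomology and base change, ★ `Modules/ProjectiveFamilyTwistPushforward`, supplies `hF` and `hbc` of the core form from
`m₀ := ⌈B(Q) − 1⌉`.) [cite: Kollar1996, I Thm. 1.10 (with proof)] [cite: Mumford1966CurvesSurface, Lecture 15 (II.) (p. 106)]
[cite: Hartshorne1977, III Thm. 12.11 (p. 290) and III Prop. 9.3 (p. 255)] -/
theorem exists_idealSheafData_containedIn_iff_of_letters [Flat (i ≫ Morphisms.projectiveSpaceFst ι T)] (Q : ℚ[X])
    (hQ : ∀ e : ℕ, regularityBound (preHilbertPoly ℚ (Nat.card ι) 0) 0 (preHilbertPoly ℚ (Nat.card ι) 0 - Q) - 1 ≤ (e : ℤ) →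
      ((⌊Q.eval (e : ℚ)⌋₊ : ℕ) : ℚ) = Q.eval (e : ℚ))
    (hletters : ∀ ⦃K : Type⦄ [Field K] ⦃X₀ : Scheme.{0}⦄ (k : X₀ ⟶ Z) (f₀ : X₀ ⟶ Spec (CommRingCat.of K))
      (x : Spec (CommRingCat.of K) ⟶ T), IsPullback k f₀ (i ≫ Morphisms.projectiveSpaceFst ι T) x →
      ∀ e : ℕ, regularityBound (preHilbertPoly ℚ (Nat.card ι) 0) 0 (preHilbertPoly ℚ (Nat.card ι) 0 - Q) - 1 ≤ (e : ℤ) →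
        Subsingleton (CategoryTheory.Abelian.Ext.{1} (unitModule X₀) ((Scheme.Modules.pullback k).obj
          (twistMod (i ≫ pullback.snd (terminal.from T) (terminal.from (Morphisms.projectiveSpaceInt ι))) (unitModule _) e)) 1) ∧
        ((Module.finrank Γ(Spec (CommRingCat.of K), ⊤) (SecMod ((Scheme.Modules.pullback k).obj
          (twistMod (i ≫ pullback.snd (terminal.from T) (terminal.from (Morphisms.projectiveSpaceInt ι))) (unitModule _) e))
          f₀.appTop.hom ⊤) : ℕ) : ℚ) = Q.eval (e : ℚ)) :
    ∃ V : T.IdealSheafData, ∀ ⦃T' : Scheme.{0}⦄ (b : T' ⟶ T),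
      V ≤ b.ker ↔ iW.ker.comap (Morphisms.projectiveSpaceMap ι b) ≤ i.ker.comap (Morphisms.projectiveSpaceMap ι b) := by
  -- the threshold `m₀ := ⌈B(Q) − 1⌉₊`
  have hm : ∀ m : ℕ, (regularityBound (preHilbertPoly ℚ (Nat.card ι) 0) 0 (preHilbertPoly ℚ (Nat.card ι) 0 - Q) - 1).toNat ≤ m →
      regularityBound (preHilbertPoly ℚ (Nat.card ι) 0) 0 (preHilbertPoly ℚ (Nat.card ι) 0 - Q) - 1 ≤ (m : ℤ) := fun m hmm =>
    (Int.self_le_toNat _).trans (by exact_mod_cast hmm)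
  have hvan : ∀ m : ℕ, (regularityBound (preHilbertPoly ℚ (Nat.card ι) 0) 0 (preHilbertPoly ℚ (Nat.card ι) 0 - Q) - 1).toNat ≤ m →
      ∀ ⦃K : Type⦄ [Field K] ⦃X₀ : Scheme.{0}⦄ (k : X₀ ⟶ Z) (f₀ : X₀ ⟶ Spec (CommRingCat.of K))
        (x : Spec (CommRingCat.of K) ⟶ T), IsPullback k f₀ (i ≫ Morphisms.projectiveSpaceFst ι T) x →
        Subsingleton (CategoryTheory.Abelian.Ext.{1} (unitModule X₀) ((Scheme.Modules.pullback k).obj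
          (twistMod (i ≫ pullback.snd (terminal.from T) (terminal.from (Morphisms.projectiveSpaceInt ι))) (unitModule _) m)) 1) :=
    fun m hmm K _ X₀ k f₀ x H => (hletters k f₀ x H m (hm m hmm)).1
  refine exists_idealSheafData_containedIn_iff i iW
    (regularityBound (preHilbertPoly ℚ (Nat.card ι) 0) 0 (preHilbertPoly ℚ (Nat.card ι) 0 - Q) - 1).toNat (fun m hmm => ?_)
    fun m hmm T' ZT' pr pT' b H => isIso_pushforwardBaseChangeHom_twistMod_of_forall_fieldPoint i m (hvan m hmm) H
  refine HasRank.isFiniteLocallyFree' (hasRank_pushforward_twistMod_of_forall_fieldPoint i m ⌊Q.eval (m : ℚ)⌋₊ (hvan m hmm)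
    fun K _ X₀ k f₀ x H => ?_)
  exact_mod_cast ((hletters k f₀ x H m (hm m hmm)).2.trans (hQ m (hm m hmm)).symm)

end Head

end Literature.AlgebraicGeometry.Motives

end
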